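import Summits.Ventures.Crystal3D.Theorems.StickyWulffConstantNoReconstructionGainCubeSteepFlat
import Summits.Ventures.Crystal3D.Theorems.StickyWulffConstantNoReconstructionGainFccShell
import HarnessLib

/-!
# Cube-steep-or-flat overlayers of the `(100)` facet gain nothing (off-lattice rung, cube facet)

HONEST FRAMING. Part of the venture `Summits/Ventures/Crystal3D` (cell `crystal3d-full`), helper
`--supports` the crux `NoReconstructionGain` (stmt-Ventures-19144, route
`route-Ventures-StickyWulffConstant`).  The `(100)` companion of `steepFlat_noGain111`
(`…SteepFlatNoGain.lean`): in the model frame of `Λ₀ = fccStacking 1 √(2/3)` the cube normal is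
`ν₁₀₀ = (√2/2, √6/6, −√3/3)` (`FccCubeFacetNoGain.lean`: `⟪barlowPos k i j, ν₁₀₀⟫ = (i+j)/√2`,
square layers `i + j = const` at spacing `1/√2`, `φ(100) = 2`).

* `cubeSteepFlat_noGain100` — with `R = 3`, `C = 24π`: for `ρ ≥ R` and every unit packing `x`
  whose bonds have each `|⟪Δx, ν₁₀₀⟫| ≤ 1/20` or `≥ √2/2`, containing every site `p ∈ Λ₀` with
  `−2R ≤ ⟪p, ν₁₀₀⟫ ≤ −R` and `‖p‖² − ⟪p, ν₁₀₀⟫² ≤ ρ²`: `4πρ² − Cρ ≤ 6N − numContacts x` — the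
  deficiency of the two flat cube faces (`2 φ(100) π ρ²`) is not beaten at order area by any such
  overlayer (in-registry or not: islands, vacancies, antiphase rafts, adatoms at hollow / bridge /
  atop heights, …).  The on-lattice rung `fcc_cubeFacet_noGain` is the special case `x ⊆ Λ₀`.
  Proof: the cube layer bound (`…CubeSteepFlat.lean`) at the sample layer `i + j = −5` (height
  `−5/√2 ∈ [−6, −3]`): every site of that layer at lateral distance `≤ ρ − 1` is a ball of `x`
  whose four lower lattice neighbours (layer `i + j = −6`, lateral offset `1/√2`) are balls of
  `x`, so it counts in `E₄`; `square_disc_count` gives `≥ π(ρ − 3)²` of them.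

WHAT THIS IS NOT: not the atom at `(100)` for overlayers with oblique bonds; rung F-C1 not moved.
-/

noncomputable section

namespace Summit.Ventures.Crystal3D.Theorems

open Summit.Ventures.Crystal3D Finset Real
open Literature.MathematicalPhysics.StatisticalMechanics (barlowPos fccStacking constHagg
  isHaggSeq_const barlowPos_mem le_dist_barlowPos_of_ideal)
open scoped InnerProductSpace

/-- The cube normal `ν₁₀₀ = (√2/2, √6/6, −√3/3)` of the model frame is a unit vector. -/
theorem norm_cubeNormal :
    ‖(!₂[Real.sqrt 2 / 2, Real.sqrt 6 / 6, -(Real.sqrt 3 / 3)] : EuclideanSpace ℝ (Fin 3))‖ = 1 := by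
  have h2 : Real.sqrt 2 ^ 2 = 2 := Real.sq_sqrt (by norm_num)
  have h6 : Real.sqrt 6 ^ 2 = 6 := Real.sq_sqrt (by norm_num)
  have h3 : Real.sqrt 3 ^ 2 = 3 := Real.sq_sqrt (by norm_num)
  have hsq : ‖(!₂[Real.sqrt 2 / 2, Real.sqrt 6 / 6, -(Real.sqrt 3 / 3)] :
      EuclideanSpace ℝ (Fin 3))‖ ^ 2 = 1 := by
    rw [EuclideanSpace.real_norm_sq_eq, Fin.sum_univ_three]
    simp
    nlinarith [h2, h6, h3]
  have h0 := norm_nonneg (!₂[Real.sqrt 2 / 2, Real.sqrt 6 / 6, -(Real.sqrt 3 / 3)] :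
    EuclideanSpace ℝ (Fin 3))
  nlinarith [hsq, h0]

/-- Lateral bookkeeping: a point of the unit square lattice at offset `(±½, ±½)` from a lattice
point inside the disc of radius `ρ − 1` (`ρ ≥ 3`) lies inside the disc of radius `ρ`. -/
theorem sq_add_sq_le_of_half_offset {u v a b ρ : ℝ} (hρ : 3 ≤ ρ) (h : u ^ 2 + v ^ 2 ≤ (ρ - 1) ^ 2)
    (ha : a ^ 2 = 1 / 4) (hb : b ^ 2 = 1 / 4) : (u + a) ^ 2 + (v + b) ^ 2 ≤ ρ ^ 2 := by
  have hρ1 : 0 ≤ ρ - 1 := by linarith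
  have hu : |u| ≤ ρ - 1 :=
    (pow_le_pow_iff_left₀ (abs_nonneg _) hρ1 two_ne_zero).1 (by rw [sq_abs]; nlinarith [sq_nonneg v])
  have hv : |v| ≤ ρ - 1 :=
    (pow_le_pow_iff_left₀ (abs_nonneg _) hρ1 two_ne_zero).1 (by rw [sq_abs]; nlinarith [sq_nonneg u])
  have h2a : |2 * a| = 1 := by
    have : (2 * a) ^ 2 = 1 := by nlinarith
    have h1 : |2 * a| ^ 2 = 1 ^ 2 := by rw [sq_abs, this]; norm_num
    exact (pow_left_inj₀ (abs_nonneg _) zero_le_one two_ne_zero).1 h1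
  have h2b : |2 * b| = 1 := by
    have : (2 * b) ^ 2 = 1 := by nlinarith
    have h1 : |2 * b| ^ 2 = 1 ^ 2 := by rw [sq_abs, this]; norm_num
    exact (pow_left_inj₀ (abs_nonneg _) zero_le_one two_ne_zero).1 h1
  have hau : 2 * a * u ≤ |u| := by
    have := le_abs_self (2 * a * u)
    rw [abs_mul, h2a, one_mul] at this; exact this
  have hbv : 2 * b * v ≤ |v| := by
    have := le_abs_self (2 * b * v)
    rw [abs_mul, h2b, one_mul] at this; exact this
  nlinarith

/-- **`CubeSteepFlatNoGain100` — off-lattice rung of the atom at the cube facet `(100)`.**  With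
`R = 3`, `C = 24π` and `ν₁₀₀ = (√2/2, √6/6, −√3/3)`: for every `ρ ≥ R` and every unit packing
`x : Fin N → ℝ³` whose bonds have each `|⟪x i − x j, ν₁₀₀⟫| ≤ 1/20` or `≥ √2/2`, containing every
site `p ∈ fccStacking 1 √(2/3)` with `−2R ≤ ⟪p, ν₁₀₀⟫ ≤ −R` and `‖p‖² − ⟪p, ν₁₀₀⟫² ≤ ρ²`:
`4 π ρ² − C ρ ≤ 6N − numContacts x`. -/
theorem cubeSteepFlat_noGain100 :
    ∃ R C : ℝ, 0 < R ∧
      ∀ ρ : ℝ, R ≤ ρ → ∀ (N : ℕ) (x : Fin N → EuclideanSpace ℝ (Fin 3)), IsUnitPacking x →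
        (∀ i j, dist (x i) (x j) = 1 →
          |⟪x i - x j, !₂[Real.sqrt 2 / 2, Real.sqrt 6 / 6, -(Real.sqrt 3 / 3)]⟫_ℝ| ≤ 1 / 20 ∨
            Real.sqrt 2 / 2 ≤
              |⟪x i - x j, !₂[Real.sqrt 2 / 2, Real.sqrt 6 / 6, -(Real.sqrt 3 / 3)]⟫_ℝ|) →
        (∀ p ∈ fccStacking 1 (Real.sqrt (2 / 3)),
            -(2 * R) ≤ ⟪p, !₂[Real.sqrt 2 / 2, Real.sqrt 6 / 6, -(Real.sqrt 3 / 3)]⟫_ℝ →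
            ⟪p, !₂[Real.sqrt 2 / 2, Real.sqrt 6 / 6, -(Real.sqrt 3 / 3)]⟫_ℝ ≤ -R →
            ‖p‖ ^ 2 - ⟪p, !₂[Real.sqrt 2 / 2, Real.sqrt 6 / 6, -(Real.sqrt 3 / 3)]⟫_ℝ ^ 2 ≤ ρ ^ 2 →
              ∃ i, x i = p) →
          4 * Real.pi * ρ ^ 2 - C * ρ ≤ 6 * (N : ℝ) - (numContacts x : ℝ) := by
  classical
  refine ⟨3, 24 * Real.pi, by norm_num, ?_⟩
  intro ρ hρ N x hx hsf hsample
  set ν : EuclideanSpace ℝ (Fin 3) := !₂[Real.sqrt 2 / 2, Real.sqrt 6 / 6, -(Real.sqrt 3 / 3)]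
    with hν
  have hνn : ‖ν‖ = 1 := norm_cubeNormal
  have h2 : Real.sqrt 2 ^ 2 = 2 := Real.sq_sqrt (by norm_num)
  have h2bnd : 7 / 5 ≤ Real.sqrt 2 ∧ Real.sqrt 2 ≤ 3 / 2 := by
    constructor <;> nlinarith [h2, Real.sqrt_nonneg 2]
  have hh : (Real.sqrt (2 / 3)) ^ 2 = 2 / 3 * (1 : ℝ) ^ 2 := by
    rw [Real.sq_sqrt (by norm_num)]; ring
  have hfcc_inj : ∀ {k₁ a₁ b₁ k₂ a₂ b₂ : ℤ},
      barlowPos 1 (Real.sqrt (2 / 3)) constHagg k₁ a₁ b₁ =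
        barlowPos 1 (Real.sqrt (2 / 3)) constHagg k₂ a₂ b₂ → (k₁, a₁, b₁) = (k₂, a₂, b₂) := by
    intro k₁ a₁ b₁ k₂ a₂ b₂ heq
    by_contra hne
    have h1 := le_dist_barlowPos_of_ideal isHaggSeq_const one_pos hh hne
    rw [heq, dist_self] at h1
    exact absurd h1 (by norm_num)
  -- heights and lateral radii of lattice sites
  have hheight : ∀ k i j : ℤ, ⟪barlowPos 1 (Real.sqrt (2 / 3)) constHagg k i j, ν⟫_ℝ =
      ((i : ℝ) + j) * (Real.sqrt 2 / 2) := fun k i j => by rw [hν, inner_barlowPos_cubeNormal]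
  have hlat : ∀ k i j : ℤ, ‖barlowPos 1 (Real.sqrt (2 / 3)) constHagg k i j‖ ^ 2 -
      ⟪barlowPos 1 (Real.sqrt (2 / 3)) constHagg k i j, ν⟫_ℝ ^ 2 =
        ((i : ℝ) ^ 2 + j ^ 2 + k ^ 2 + i * j + i * k + j * k) - ((i : ℝ) + j) ^ 2 / 2 := by
    intro k i j
    rw [hheight, norm_sq_barlowPos_fcc]; push_cast
    nlinarith [h2]
  -- a lattice site of the slab with lateral radius `≤ ρ` is a ball of `x`
  have hball : ∀ k i j : ℤ, (i + j = -5 ∨ i + j = -6) →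
      ((i : ℝ) ^ 2 + j ^ 2 + k ^ 2 + i * j + i * k + j * k) - ((i : ℝ) + j) ^ 2 / 2 ≤ ρ ^ 2 →
      ∃ i₀, x i₀ = barlowPos 1 (Real.sqrt (2 / 3)) constHagg k i j := by
    intro k i j hs hl
    refine hsample _ (barlowPos_mem _ _ _) ?_ ?_ ?_
    · rw [hheight]
      rcases hs with hs | hs
      · have : (i : ℝ) + j = -5 := by exact_mod_cast hs
        rw [this]; nlinarith [h2bnd.1, h2bnd.2]
      · have : (i : ℝ) + j = -6 := by exact_mod_cast hs
        rw [this]; nlinarith [h2bnd.1, h2bnd.2]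
    · rw [hheight]
      rcases hs with hs | hs
      · have : (i : ℝ) + j = -5 := by exact_mod_cast hs
        rw [this]; nlinarith [h2bnd.1, h2bnd.2]
      · have : (i : ℝ) + j = -6 := by exact_mod_cast hs
        rw [this]; nlinarith [h2bnd.1, h2bnd.2]
    · rw [hlat]; exact hl
  -- the cube layer bound at the level `c = -5 (√2/2)` (layer `i + j = -5`)
  set c : ℝ := (-5 : ℝ) * (Real.sqrt 2 / 2) with hc
  have hlayer := three_mul_card_level_add_card_add_numContacts_le_cube ν hνn x hx hsf c
  set E4 := univ.filter fun i => ⟪x i, ν⟫_ℝ = c ∧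
    4 ≤ (univ.filter fun j => dist (x i) (x j) = 1 ∧ ⟪x j - x i, ν⟫_ℝ ≤ -(Real.sqrt 2 / 2)).card
    with hE4
  -- the sites of layer `i + j = -5` inside lateral radius `ρ - 1` belong to `E4`
  set g : Fin N → ℤ × ℤ := fun i' =>
    if h : ∃ ik : ℤ × ℤ, x i' = barlowPos 1 (Real.sqrt (2 / 3)) constHagg ik.2 ik.1 (-5 - ik.1)
    then h.choose else (0, 0) with hg
  set T : Finset (ℤ × ℤ) := E4.image g with hT
  have hTE : T.card ≤ E4.card := card_image_le
  have hρ1 : 2 ≤ ρ - 1 := by linarith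
  have hdisc := square_disc_count (-5 / 2) (5 / 2) (ρ - 1) hρ1 T ?_
  swap
  · intro i k hcond
    have hcond' : ((i : ℝ) + 5 / 2) ^ 2 + ((k : ℝ) - 5 / 2) ^ 2 ≤ (ρ - 1) ^ 2 := by
      have e : ((i : ℝ) - (-5 / 2)) ^ 2 = ((i : ℝ) + 5 / 2) ^ 2 := by ring
      rw [e] at hcond; exact hcond
    -- the site and its four lower neighbours are balls of `x`
    have hlat0 : ((i : ℝ) ^ 2 + (-5 - i : ℤ) ^ 2 + k ^ 2 + i * (-5 - i : ℤ) + i * k + (-5 - i : ℤ) * k)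
        - ((i : ℝ) + (-5 - i : ℤ)) ^ 2 / 2 = ((i : ℝ) + 5 / 2) ^ 2 + ((k : ℝ) - 5 / 2) ^ 2 := by
      push_cast; ring
    obtain ⟨i₀, hi₀⟩ := hball k i (-5 - i) (Or.inl (by omega)) (by
      rw [hlat0]; nlinarith [hcond'])
    -- four lower neighbours: offsets (Δk, Δi, Δj) ∈ {(0,-1,0), (0,0,-1), (1,-1,0), (1,0,-1)}
    have hnb : ∀ dk di : ℤ, (dk = 0 ∨ dk = 1) → (di = 0 ∨ di = -1) →
        ∃ j₀, x j₀ = barlowPos 1 (Real.sqrt (2 / 3)) constHagg (k + dk) (i + di) (-6 - i - di) ∧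
          dist (x i₀) (x j₀) = 1 ∧ ⟪x j₀ - x i₀, ν⟫_ℝ ≤ -(Real.sqrt 2 / 2) := by
      intro dk di hdk hdi
      have hlat1 : ((i + di : ℤ) ^ 2 + (-6 - i - di : ℤ) ^ 2 + (k + dk : ℤ) ^ 2 +
          (i + di : ℤ) * (-6 - i - di : ℤ) + (i + di : ℤ) * (k + dk : ℤ) +
          (-6 - i - di : ℤ) * (k + dk : ℤ) : ℝ) - ((i + di : ℤ) + (-6 - i - di : ℤ) : ℝ) ^ 2 / 2 =
          (((i : ℝ) + 5 / 2) + ((di : ℝ) + 1 / 2)) ^ 2 + (((k : ℝ) - 5 / 2) + ((dk : ℝ) - 1 / 2)) ^ 2 := by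
        push_cast; ring
      have hda : ((di : ℝ) + 1 / 2) ^ 2 = 1 / 4 := by
        rcases hdi with h | h <;> simp [h] <;> norm_num
      have hdb : ((dk : ℝ) - 1 / 2) ^ 2 = 1 / 4 := by
        rcases hdk with h | h <;> simp [h] <;> norm_num
      obtain ⟨j₀, hj₀⟩ := hball (k + dk) (i + di) (-6 - i - di) (Or.inr (by omega)) (by
        have := sq_add_sq_le_of_half_offset hρ hcond' hda hdb
        push_cast at hlat1 this ⊢
        rw [hlat1]; exact this)
      refine ⟨j₀, hj₀, ?_, ?_⟩
      · rw [hi₀, hj₀, dist_eq_norm, barlowPos_fcc_sub]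
        apply norm_barlowPos_fcc_eq_one
        rcases hdk with h | h <;> rcases hdi with h' | h' <;> simp [h, h'] <;> ring
      · rw [hi₀, hj₀, inner_sub_left, hheight, hheight]; push_cast
        nlinarith [h2bnd.1]
    obtain ⟨j₁, hj₁, hd₁, hz₁⟩ := hnb 0 0 (Or.inl rfl) (Or.inl rfl)
    obtain ⟨j₂, hj₂, hd₂, hz₂⟩ := hnb 0 (-1) (Or.inl rfl) (Or.inr rfl)
    obtain ⟨j₃, hj₃, hd₃, hz₃⟩ := hnb 1 0 (Or.inr rfl) (Or.inl rfl)
    obtain ⟨j₄, hj₄, hd₄, hz₄⟩ := hnb 1 (-1) (Or.inr rfl) (Or.inr rfl)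
    -- they are four distinct balls
    have hne : ∀ {a b : Fin N} {ka ia ja kb ib jb : ℤ},
        x a = barlowPos 1 (Real.sqrt (2 / 3)) constHagg ka ia ja →
        x b = barlowPos 1 (Real.sqrt (2 / 3)) constHagg kb ib jb → (ka, ia, ja) ≠ (kb, ib, jb) →
        a ≠ b := by
      intro a b ka ia ja kb ib jb ha hb hneq hab
      rw [hab] at ha
      exact hneq (hfcc_inj (ha.symm.trans hb))
    have h12 : j₁ ≠ j₂ := hne hj₁ hj₂ (by simp)
    have h13 : j₁ ≠ j₃ := hne hj₁ hj₃ (by simp)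
    have h14 : j₁ ≠ j₄ := hne hj₁ hj₄ (by simp)
    have h23 : j₂ ≠ j₃ := hne hj₂ hj₃ (by simp)
    have h24 : j₂ ≠ j₄ := hne hj₂ hj₄ (by simp)
    have h34 : j₃ ≠ j₄ := hne hj₃ hj₄ (by simp)
    have h4 : 4 ≤ (univ.filter fun j => dist (x i₀) (x j) = 1 ∧
        ⟪x j - x i₀, ν⟫_ℝ ≤ -(Real.sqrt 2 / 2)).card := by
      have hsub : ({j₁, j₂, j₃, j₄} : Finset (Fin N)) ⊆
          univ.filter fun j => dist (x i₀) (x j) = 1 ∧ ⟪x j - x i₀, ν⟫_ℝ ≤ -(Real.sqrt 2 / 2) := by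
        intro j hj
        simp only [mem_insert, mem_singleton] at hj
        rw [mem_filter]
        rcases hj with rfl | rfl | rfl | rfl
        · exact ⟨mem_univ _, hd₁, hz₁⟩
        · exact ⟨mem_univ _, hd₂, hz₂⟩
        · exact ⟨mem_univ _, hd₃, hz₃⟩
        · exact ⟨mem_univ _, hd₄, hz₄⟩
      have hc4 : ({j₁, j₂, j₃, j₄} : Finset (Fin N)).card = 4 := by
        rw [card_insert_of_notMem (by simp [h12, h13, h14]),
          card_insert_of_notMem (by simp [h23, h24]), card_insert_of_notMem (by simp [h34]),
          card_singleton]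
      exact hc4 ▸ card_le_card hsub
    have hi₀E : i₀ ∈ E4 := by
      rw [hE4, mem_filter]
      refine ⟨mem_univ _, ?_, h4⟩
      rw [hi₀, hheight, hc]; push_cast; ring
    have hex : ∃ ik : ℤ × ℤ, x i₀ = barlowPos 1 (Real.sqrt (2 / 3)) constHagg ik.2 ik.1 (-5 - ik.1) :=
      ⟨(i, k), hi₀⟩
    have hgi : g i₀ = (i, k) := by
      have hspec := hex.choose_spec
      have := hfcc_inj (hi₀.symm.trans hspec)
      simp only [Prod.mk.injEq] at this
      rw [hg]; simp only [hex, dif_pos]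
      exact Prod.ext this.2.1.symm this.1.symm
    rw [hT, mem_image]
    exact ⟨i₀, hi₀E, hgi⟩
  -- assemble
  have hE' : (3 * ((univ.filter fun i => ⟪x i, ν⟫_ℝ = c).card : ℝ) + (E4.card : ℝ)) +
      (numContacts x : ℝ) ≤ 6 * (N : ℝ) := by exact_mod_cast hlayer
  have hEE : (E4.card : ℝ) ≤ ((univ.filter fun i => ⟪x i, ν⟫_ℝ = c).card : ℝ) := by
    have : E4 ⊆ univ.filter fun i => ⟪x i, ν⟫_ℝ = c := by
      intro i hi; rw [hE4, mem_filter] at hi; rw [mem_filter]; exact ⟨hi.1, hi.2.1⟩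
    exact_mod_cast card_le_card this
  have hTE' : (T.card : ℝ) ≤ (E4.card : ℝ) := by exact_mod_cast hTE
  nlinarith [hdisc, Real.pi_pos]

end Summit.Ventures.Crystal3D.Theorems

end
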